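import Summits.CriticalPhenomena.PercolationContinuityZ3.Theorems.SahiMasterFamilyCombSandwichApex

/-!
# The comb lift of one-face domination (1-minor side), II: the `ZVia` packaging

Unit `prim-master-conj` (crux anchor stmt-CriticalPhenomena-4575, helper work), gen 19; memo
`run/shared/lean/prim/prim-l12/prim-master-conj/POINTWISE.md` §20 addendum 2.  Part I (`…CombSandwichApex`) proves, in SANDWICH-DATA form
(`K` increasing and ignoring `e`, `G ⊆ K`, `X ∩ K ⊆ G`, the four moment relations at every `p`), that along a coordinate `e` whose `1`-minor is a
zero flag the two middle one-coordinate Bernstein functionals are comb-positive off `e` and that (M⁺-3) is inherited from the `0`-minor.  This file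
discharges the sandwich data from `ZVia (A¹) (B¹) (D¹)` (gen 18's `sandwich_moments_of_zVia`, `sandwich_left`, with `K` the forced hull
`{ω | ω ∪ (esupp A¹ ∪ esupp B¹) ∈ D¹}`, which ignores `e` because `D¹` does and `insert e (ω ∪ S) = insert e ω ∪ S`):
* **`combPos_sahiE_three_of_zVia`** — (M⁺-3) is inherited along a zero-flag `1`-minor: if `ZVia A¹ B¹ D¹` (`A¹, B¹` nonempty) and the `0`-minor
  `(A⁰,B⁰,D⁰)` is comb-positive off `e`, then `p ↦ E_3(μ_p; 1_A,1_B,1_D)` is comb-positive at multidegree `3` — a new closure property of the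
  comb-positive class at order 3 (the comb lift of gen 18's `sahiE_three_settled_of_zVia`);
* `combPos_mixC2_of_zVia`, `combPos_mixC1_sub_of_zVia` — comb ORDER-1(3) along `e` (TOP `c₂ ≥ c₃ = 0` and BOTTOM `c₁ ≥ c₀`, INEQ-CLAIMS row COMB-M-E3)
  holds UNCONDITIONALLY for every increasing triple whose `e`-`1`-minor is a zero flag.
HONEST FRAMING: (M⁺-3), COMB-M-E3, `C_3` remain OPEN in general. [this work]
-/

noncomputable section

open scoped Classical

namespace Summit.CriticalPhenomena.PercolationContinuityZ3.Theorems

open Finset Function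
open Literature.Combinatorics.Sahi2008
open Literature.Probability.Percolation.DecisionTree (ind)
open SahiComb SahiCombMix

namespace Pointwise

variable {ι : Type} [Fintype ι]

/-! ### 2. The `ZVia` packaging: hypotheses discharged by the forced hull of the `1`-minor -/

section ZeroFlagOne

variable (e : ι) (A B D : Set (Set ι)) (hAu : IsUpperSet A) (hBu : IsUpperSet B) (hDu : IsUpperSet D)
  (hAne : (secAt e true A).Nonempty) (hBne : (secAt e true B).Nonempty)
  (hZ : ZVia (secAt e true A) (secAt e true B) (secAt e true D))
include hAu hBu hDu hAne hBne hZ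

/-- **(M⁺-3) IS INHERITED ALONG A ZERO-FLAG `1`-MINOR.**  If the `1`-minor `(A¹, B¹, D¹)` of an increasing triple `(A, B, D)` along `e` is a zero flag via
the pair `(A¹, B¹)` (`A¹, B¹` nonempty) and the `0`-minor `(A⁰, B⁰, D⁰)` is comb-positive off `e`, then `p ↦ E_3(μ_p; 1_A, 1_B, 1_D)` is comb-positive at
multidegree `3` (all tensor-Bernstein coefficients `≥ 0`).  With it come the unconditional comb ORDER-1(3) statements along `e`
(`combPos_mixC2_of_sandwich`, `combPos_mixC1_sub_of_sandwich`, same discharge). [this work] -/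
theorem combPos_sahiE_three_of_zVia
    (h0 : CombPos (update (fun _ : ι => 3) e 0) (fun p => sahiE (bernoulliWeight p) 3 (fun j => ind (secAt e false (![A, B, D] j))))) :
    CombPos (fun _ : ι => 3) (fun p => sahiE (bernoulliWeight p) 3 (fun j => ind ((![A, B, D]) j))) := by
  set K : Set (Set ι) := {ω : Set ι | ω ∪ ↑(esupp (secAt e true A) ∪ esupp (secAt e true B)) ∈ secAt e true D} with hK
  have hXu := isUpperSet_secAt e true hAu
  have hYu := isUpperSet_secAt e true hBu
  have hGu := isUpperSet_secAt e true hDu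
  have hKu : IsUpperSet K := isUpperSet_forcedHull hGu _
  have hKe : ∀ ω, insert e ω ∈ K ↔ ω ∈ K := by
    intro ω
    simp only [hK, Set.mem_setOf_eq, Set.insert_union]
    exact insert_mem_secAt_iff e true D _
  have hmom := fun p : ι → unitInterval => sandwich_moments_of_zVia p hXu hYu hGu hAne hBne hZ
  have hGK : secAt e true D ⊆ K := (hmom (fun _ => 0)).2.2.2.2
  have hXK : secAt e true A ∩ K ⊆ secAt e true D := by
    rw [← sandwich_left hXu hYu hGu hBne hZ]
    exact Set.inter_subset_right
  exact combPos_sahiE_three_of_sandwich e A B D K hAu hBu hDu hKu hKe hGK hXK (fun p => (hmom p).1) (fun p => (hmom p).2.1)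
    (fun p => (hmom p).2.2.1) (fun p => (hmom p).2.2.2.1) h0

/-- **Comb ORDER-1(3) along `e`, TOP half, for a `ZVia` `1`-minor** (unconditional): `mixC2` is comb-positive off `e`. [this work] -/
theorem combPos_mixC2_of_zVia :
    CombPos (update (fun _ : ι => 3) e 0)
      (fun p => mixC2 (bernoulliWeight p) (fun j => secAt e false (![A, B, D] j)) (fun j => secAt e true (![A, B, D] j))) := by
  set K : Set (Set ι) := {ω : Set ι | ω ∪ ↑(esupp (secAt e true A) ∪ esupp (secAt e true B)) ∈ secAt e true D} with hK
  have hXu := isUpperSet_secAt e true hAu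
  have hYu := isUpperSet_secAt e true hBu
  have hGu := isUpperSet_secAt e true hDu
  have hKu : IsUpperSet K := isUpperSet_forcedHull hGu _
  have hKe : ∀ ω, insert e ω ∈ K ↔ ω ∈ K := by
    intro ω
    simp only [hK, Set.mem_setOf_eq, Set.insert_union]
    exact insert_mem_secAt_iff e true D _
  have hmom := fun p : ι → unitInterval => sandwich_moments_of_zVia p hXu hYu hGu hAne hBne hZ
  have hGK : secAt e true D ⊆ K := (hmom (fun _ => 0)).2.2.2.2
  have hXK : secAt e true A ∩ K ⊆ secAt e true D := by
    rw [← sandwich_left hXu hYu hGu hBne hZ]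
    exact Set.inter_subset_right
  exact combPos_mixC2_of_sandwich e A B D K hAu hBu hDu hKu hKe hGK hXK (fun p => (hmom p).1) (fun p => (hmom p).2.1)
    (fun p => (hmom p).2.2.1) (fun p => (hmom p).2.2.2.1)

/-- **Comb ORDER-1(3) along `e`, BOTTOM half, for a `ZVia` `1`-minor** (unconditional): `mixC1 − E_3(U⁰)` is comb-positive off `e`. [this work] -/
theorem combPos_mixC1_sub_of_zVia :
    CombPos (update (fun _ : ι => 3) e 0)
      (fun p => mixC1 (bernoulliWeight p) (fun j => secAt e false (![A, B, D] j)) (fun j => secAt e true (![A, B, D] j))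
        - sahiE (bernoulliWeight p) 3 (fun j => ind (secAt e false (![A, B, D] j)))) := by
  set K : Set (Set ι) := {ω : Set ι | ω ∪ ↑(esupp (secAt e true A) ∪ esupp (secAt e true B)) ∈ secAt e true D} with hK
  have hXu := isUpperSet_secAt e true hAu
  have hYu := isUpperSet_secAt e true hBu
  have hGu := isUpperSet_secAt e true hDu
  have hKu : IsUpperSet K := isUpperSet_forcedHull hGu _
  have hKe : ∀ ω, insert e ω ∈ K ↔ ω ∈ K := by
    intro ω
    simp only [hK, Set.mem_setOf_eq, Set.insert_union]
    exact insert_mem_secAt_iff e true D _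
  have hmom := fun p : ι → unitInterval => sandwich_moments_of_zVia p hXu hYu hGu hAne hBne hZ
  have hGK : secAt e true D ⊆ K := (hmom (fun _ => 0)).2.2.2.2
  have hXK : secAt e true A ∩ K ⊆ secAt e true D := by
    rw [← sandwich_left hXu hYu hGu hBne hZ]
    exact Set.inter_subset_right
  exact combPos_mixC1_sub_of_sandwich e A B D K hAu hBu hDu hKu hKe hGK hXK (fun p => (hmom p).1) (fun p => (hmom p).2.1)
    (fun p => (hmom p).2.2.1) (fun p => (hmom p).2.2.2.1)

end ZeroFlagOne

end Pointwise

end Summit.CriticalPhenomena.PercolationContinuityZ3.Theorems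

end
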